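import Summits.HodgeConjecture.HodgeConjecture.Theorems.MarkmanPartnerTransportPartnerExistenceComplexify

/-!
# Route MarkmanPartnerTransport · support `PartnerExistence` (stmt-HodgeConjecture-19655) —
# complexified rational maps between `ℚ²³` and `ℚ²²`: spans, inverses, orthogonality

Linear-algebra bricks for reading the transcendental Hodge isometry `g = φ⁻¹ ∘ G_ℂ ∘ η` of the K3 partner
off a pair of `ℚ`-linear maps `F : ℚ²³ → ℚ²²` (isometric embedding of `T_ℚ`, zero on `N_ℚ`) and
`G : ℚ²² → ℚ²³` (its inverse on `W = F(T_ℚ)`, zero on `M = W^⊥`), complexified as rational matrices read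
over `ℂ` (`Matrix.toLin' ((LinearMap.toMatrix' ·).map (ℚ → ℂ))`).  Everything is bilinear / linear extension
from rational generators:

* `cplx_ratCast`, `cplx_star` (generic index types), `mem_span_of_forall_ratCast`, `cplx_mem_span` — a complexified
  rational map lands in `R ⊗ ℂ` as soon as it maps `ℚ`-vectors into `R`;
* `cplx_cplx_of_mem_span` — `G_ℂ ∘ F_ℂ = id` on `T ⊗ ℂ` if `G ∘ F = id` on `T`;
* `k3Form_eq_zero_of_mem_span` — `(M ⊗ ℂ . W ⊗ ℂ) = 0` if `(M . W) = 0`;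
* `k3HilbertForm_cy_cy` — `q(G_ℂ v, G_ℂ v') = (v.v')` on `W ⊗ ℂ` if `G` is an isometry on `W`;
* `mem_span_ratCast_of_orthogonal` — **`(W^⊥ ⊗ ℂ)^⊥ = W ⊗ ℂ`** in `Λ_{K3} ⊗ ℂ` (dimension count).

No definition, no sorry, no named fact. Prover seat hodge-nonav-19652-p1 (gen 5), `--supports stmt-HodgeConjecture-19655`.

References: D. Huybrechts, *Lectures on K3 Surfaces*, Ch. 3 §2 (transcendental lattice, `T ⊗ ℂ`);
D. Morrison, Invent. Math. 75 (1984) §1–2.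
-/

noncomputable section

set_option linter.dupNamespace false

open scoped Matrix
open Module CategoryTheory
open Literature.AlgebraicTopology.SingularHomology Literature.Geometry.Kaehler
open Literature.AlgebraicGeometry Literature.AlgebraicGeometry.Motives Literature.AlgebraicGeometry.HodgeTheory
open Literature.AlgebraicGeometry.Hyperkaehler Literature.AlgebraicGeometry.Surfaces
open Summit.HodgeConjecture.HodgeConjecture.Theorems.NikulinTwinTransport
open Summit.HodgeConjecture.HodgeConjecture.Theorems.AnchorExistenceCMFloor

namespace Summit.HodgeConjecture.HodgeConjecture.Theorems.MarkmanPartnerTransport.PartnerLattice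

/-- `qQ` = the rational Beauville–Bogomolov form of `K3^{[2]}`-type on `ℚ²³`. Local notation only. -/
local notation3 (prettyPrint := false) "qQ" => Matrix.toBilin' (Matrix.map (k3HilbertGram 2) (Int.cast : ℤ → ℚ))

/-- `cx[F]` = the complexification of a `ℚ`-linear `F : ℚ²³ → ℚ²²`. Local notation only. -/
local notation3 (prettyPrint := false) "cx[" F "]" =>
  Matrix.toLin' (Matrix.map (LinearMap.toMatrix' (R := ℚ) F) (Rat.cast : ℚ → ℂ))

/-- `cy[G]` = the complexification of a `ℚ`-linear `G : ℚ²² → ℚ²³`. Local notation only. -/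
local notation3 (prettyPrint := false) "cy[" G "]" =>
  Matrix.toLin' (Matrix.map (LinearMap.toMatrix' (R := ℚ) G) (Rat.cast : ℚ → ℂ))

/-! ### Generic complexification of rational maps `ℚ^m → ℚ^n` -/

section Generic

variable {m n : Type} [Fintype m] [DecidableEq m]

/-- A complexified rational map extends the rational map. [folklore] -/
theorem cplx_ratCast (H : (m → ℚ) →ₗ[ℚ] (n → ℚ)) (v : m → ℚ) :
    Matrix.toLin' (Matrix.map (LinearMap.toMatrix' H) (Rat.cast : ℚ → ℂ)) (fun i => (v i : ℂ)) =
      fun i => ((H v) i : ℂ) := by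
  rw [Matrix.toLin'_apply]
  funext i
  have h := (RingHom.map_mulVec (Rat.castHom ℂ) (LinearMap.toMatrix' H) v i).symm
  rw [LinearMap.toMatrix'_mulVec] at h
  simp only [Rat.coe_castHom, Function.comp_def] at h
  exact h

/-- A complexified rational map commutes with complex conjugation. [folklore] -/
theorem cplx_star (H : (m → ℚ) →ₗ[ℚ] (n → ℚ)) (w : m → ℂ) :
    Matrix.toLin' (Matrix.map (LinearMap.toMatrix' H) (Rat.cast : ℚ → ℂ)) (star w) =
      star (Matrix.toLin' (Matrix.map (LinearMap.toMatrix' H) (Rat.cast : ℚ → ℂ)) w) := by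
  rw [Matrix.toLin'_apply, Matrix.toLin'_apply]
  funext i
  simp only [Matrix.mulVec, dotProduct, Matrix.map_apply, Pi.star_apply, star_sum, star_mul',
    Complex.star_def, map_ratCast]

/-- **A `ℂ`-linear map sending rational vectors into `R ⊗ ℂ` lands in `R ⊗ ℂ`.** [folklore] -/
theorem mem_span_of_forall_ratCast (H : (m → ℂ) →ₗ[ℂ] (n → ℂ)) (R : Submodule ℚ (n → ℚ))
    (h : ∀ w : m → ℚ, H (fun i => (w i : ℂ)) ∈
      Submodule.span ℂ ((fun a : n → ℚ => fun i => (a i : ℂ)) '' (R : Set (n → ℚ))))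
    (y : m → ℂ) :
    H y ∈ Submodule.span ℂ ((fun a : n → ℚ => fun i => (a i : ℂ)) '' (R : Set (n → ℚ))) := by
  rw [eq_sum_smul_intCastVec_single y, map_sum]
  refine Submodule.sum_mem _ fun j _ => ?_
  rw [map_smul, intCastVec_eq_ratCastVec]
  exact Submodule.smul_mem _ _ (h _)

/-- **A complexified rational map with values in `R` lands in `R ⊗ ℂ`.** [folklore] -/
theorem cplx_mem_span (H : (m → ℚ) →ₗ[ℚ] (n → ℚ)) (R : Submodule ℚ (n → ℚ)) (hH : ∀ v, H v ∈ R)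
    (y : m → ℂ) :
    Matrix.toLin' (Matrix.map (LinearMap.toMatrix' H) (Rat.cast : ℚ → ℂ)) y ∈
      Submodule.span ℂ ((fun a : n → ℚ => fun i => (a i : ℂ)) '' (R : Set (n → ℚ))) := by
  refine mem_span_of_forall_ratCast _ R (fun w => ?_) y
  rw [cplx_ratCast]
  exact Submodule.subset_span ⟨H w, hH w, rfl⟩

/-- **`K_ℂ ∘ H_ℂ = id` on `R ⊗ ℂ` if `K ∘ H = id` on `R`.** [folklore] -/
theorem cplx_cplx_of_mem_span [Fintype n] [DecidableEq n] (H : (m → ℚ) →ₗ[ℚ] (n → ℚ)) (K : (n → ℚ) →ₗ[ℚ] (m → ℚ))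
    (R : Submodule ℚ (m → ℚ)) (hKH : ∀ r ∈ R, K (H r) = r) {y : m → ℂ}
    (hy : y ∈ Submodule.span ℂ ((fun a : m → ℚ => fun i => (a i : ℂ)) '' (R : Set (m → ℚ)))) :
    Matrix.toLin' (Matrix.map (LinearMap.toMatrix' K) (Rat.cast : ℚ → ℂ))
      (Matrix.toLin' (Matrix.map (LinearMap.toMatrix' H) (Rat.cast : ℚ → ℂ)) y) = y := by
  induction hy using Submodule.span_induction with
  | mem x hx =>
    obtain ⟨r, hr, rfl⟩ := hx
    beta_reduce
    rw [cplx_ratCast, cplx_ratCast, hKH r hr]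
  | zero => rw [map_zero, map_zero]
  | add x y _ _ hx hy => rw [map_add, map_add, hx, hy]
  | smul c x _ hx => rw [map_smul, map_smul, hx]

end Generic

/-! ### Orthogonality and isometry over `ℂ` in `Λ_{K3} ⊗ ℂ` -/

/-- **`(M ⊗ ℂ . W ⊗ ℂ) = 0` if `(M . W) = 0`.** [folklore] -/
theorem k3Form_eq_zero_of_mem_span (W M : Submodule ℚ (K3Index → ℚ))
    (hMW : ∀ m ∈ M, ∀ w ∈ W, k3FormRat m w = 0) {a b : K3Index → ℂ}
    (ha : a ∈ Submodule.span ℂ ((fun v : K3Index → ℚ => fun i => (v i : ℂ)) '' (M : Set (K3Index → ℚ))))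
    (hb : b ∈ Submodule.span ℂ ((fun v : K3Index → ℚ => fun i => (v i : ℂ)) '' (W : Set (K3Index → ℚ)))) :
    k3Form a b = 0 := by
  induction hb using Submodule.span_induction with
  | mem x hx =>
    obtain ⟨w, hw, rfl⟩ := hx
    induction ha using Submodule.span_induction with
    | mem y hy =>
      obtain ⟨m', hm', rfl⟩ := hy
      beta_reduce
      rw [k3Form_ratCast, hMW m' hm' w hw, Rat.cast_zero]
    | zero => rw [k3Form_zero_left]
    | add x y _ _ hx hy => rw [k3Form_add_left, hx, hy, add_zero]
    | smul c x _ hx => rw [k3Form_smul_left, hx, mul_zero]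
  | zero => rw [k3Form_zero_right]
  | add x y _ _ hx hy => rw [k3Form_add_right, hx, hy, add_zero]
  | smul c x _ hx => rw [k3Form_smul_right, hx, mul_zero]

/-- **`q(G_ℂ v, G_ℂ v') = (v . v')` on `W ⊗ ℂ`** if `G : ℚ²² → ℚ²³` is an isometry on `W`. [folklore] -/
theorem k3HilbertForm_cy_cy (G : (K3Index → ℚ) →ₗ[ℚ] (K3HilbertIndex → ℚ)) (W : Submodule ℚ (K3Index → ℚ))
    (hG : ∀ w ∈ W, ∀ w' ∈ W, qQ (G w) (G w') = k3FormRat w w') {v v' : K3Index → ℂ}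
    (hv : v ∈ Submodule.span ℂ ((fun a : K3Index → ℚ => fun i => (a i : ℂ)) '' (W : Set (K3Index → ℚ))))
    (hv' : v' ∈ Submodule.span ℂ ((fun a : K3Index → ℚ => fun i => (a i : ℂ)) '' (W : Set (K3Index → ℚ)))) :
    k3HilbertForm 2 (cy[G] v) (cy[G] v') = k3Form v v' := by
  induction hv' using Submodule.span_induction with
  | mem x' hx' =>
    obtain ⟨w', hw', rfl⟩ := hx'
    induction hv using Submodule.span_induction with
    | mem x hx =>
      obtain ⟨w, hw, rfl⟩ := hx
      beta_reduce
      rw [cplx_ratCast, cplx_ratCast, k3HilbertForm_ratCast, hG w hw w' hw', k3Form_ratCast]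
    | zero =>
      rw [map_zero, k3Form_zero_left]
      simp [k3HilbertForm_apply]
    | add x y _ _ hx hy => rw [map_add, k3HilbertForm_add_left, k3Form_add_left, hx, hy]
    | smul c x _ hx => rw [map_smul, k3HilbertForm_smul_left, k3Form_smul_left, hx]
  | zero =>
    rw [map_zero, k3Form_zero_right]
    simp [k3HilbertForm_apply]
  | add x y _ _ hx hy => rw [map_add, k3HilbertForm_add_right, k3Form_add_right, hx, hy]
  | smul c x _ hx => rw [map_smul, k3HilbertForm_smul_right, k3Form_smul_right, hx]

/-- `dim ℂ²² = 22`. [cite: Huybrechts2016K3, Ch. 1 Prop. 3.5] -/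
theorem finrank_k3Complex : finrank ℂ (K3Index → ℂ) = 22 := by
  rw [finrank_fintype_fun_eq_card]
  rfl

/-- **`(W^⊥ ⊗ ℂ)^⊥ = W ⊗ ℂ` in `Λ_{K3} ⊗ ℂ`**: a complex vector orthogonal to the rational vectors of
`W^⊥` lies in `W ⊗ ℂ` (inclusion `W ⊗ ℂ ⊆ (W^⊥ ⊗ ℂ)^⊥` and the dimension count `dim W`).
[cite: Huybrechts2016K3, Ch. 3 Lemma 3.1] -/
theorem mem_span_ratCast_of_orthogonal (W : Submodule ℚ (K3Index → ℚ)) {v : K3Index → ℂ}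
    (hv : ∀ m ∈ k3FormRat.orthogonal W, k3Form v (fun i => (m i : ℂ)) = 0) :
    v ∈ Submodule.span ℂ ((fun a : K3Index → ℚ => fun i => (a i : ℂ)) '' (W : Set (K3Index → ℚ))) := by
  set MC := Submodule.span ℂ ((fun a : K3Index → ℚ => fun i => (a i : ℂ)) ''
    (k3FormRat.orthogonal W : Set (K3Index → ℚ))) with hMC
  set WC := Submodule.span ℂ ((fun a : K3Index → ℚ => fun i => (a i : ℂ)) '' (W : Set (K3Index → ℚ))) with hWC
  have horth : ∀ y : K3Index → ℂ, (∀ m ∈ k3FormRat.orthogonal W, k3Form y (fun i => (m i : ℂ)) = 0) →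
      y ∈ k3FormC.orthogonal MC := by
    intro y hy
    rw [LinearMap.BilinForm.mem_orthogonal_iff]
    intro a ha
    show k3FormC a y = 0
    have hle : MC ≤ LinearMap.ker (k3FormC y) := by
      refine Submodule.span_le.2 ?_
      rintro _ ⟨m', hm', rfl⟩
      rw [SetLike.mem_coe, LinearMap.mem_ker, k3FormC_apply]
      exact hy m' hm'
    have h := hle ha
    rw [LinearMap.mem_ker, k3FormC_apply] at h
    rw [k3FormC_apply, k3Form_comm]
    exact h
  have hle : WC ≤ k3FormC.orthogonal MC := by
    refine Submodule.span_le.2 ?_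
    rintro _ ⟨w, hw, rfl⟩
    refine horth _ fun m' hm' => ?_
    rw [k3Form_ratCast, (LinearMap.BilinForm.mem_orthogonal_iff.1 hm') w hw, Rat.cast_zero]
  -- `k3FormC` is non-degenerate (`det Λ_{K3} = -1`; also `NikulinTwinTransport.k3FormC_nondegenerate`,
  -- not importable here without entering that route's theses cone)
  have hCn : k3FormC.Nondegenerate := by
    rw [k3FormC]
    refine LinearMap.BilinForm.nondegenerate_toBilin'_of_det_ne_zero' _ ?_
    rw [← Int.cast_det, k3Gram_det]
    norm_num
  have hfin : finrank ℂ (k3FormC.orthogonal MC) ≤ finrank ℂ WC := by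
    rw [LinearMap.BilinForm.finrank_orthogonal hCn, hMC, finrank_span_ratCast, hWC,
      finrank_span_ratCast, LinearMap.BilinForm.finrank_orthogonal k3FormRat_nondegenerate, finrank_k3Rat,
      finrank_k3Complex]
    have := Submodule.finrank_le W
    rw [finrank_k3Rat] at this
    omega
  rw [Submodule.eq_of_le_of_finrank_le hle hfin]
  exact horth v hv

end Summit.HodgeConjecture.HodgeConjecture.Theorems.MarkmanPartnerTransport.PartnerLattice

end
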